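import Summits.AtomisticToContinuum.Crystallization.Theorems.FrustratedLawDichotomyStrainedPatchHostCells

/-!
(SPLIT FOR THE 400-LINE CAP by the landing lane, hand-2 g29: this file = part A; part B = `…FrustratedLawDichotomyStrainedPatchGaugeCells` imports it; same namespace, all FQNs unchanged.)
# GAUGE CELLS for the 27623 strained-patch line of record (decomp-a2c lens-5 g63)

Target of record (61H, tree `…StrainedPatchHostCells`): `[CORE-FAR] = CoreOffTubeFloor (63/10) (63/10) (24/5) (1/100) 0 ⟸ TubeP ∧ CoverP`,
`TubeP := TubeFloor FamP (1/80)`, `FamP := bentFamilyW bends0 (1/8)`; 62B (HOME `…BentCells`, generic in the family `𝓘`):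
`TubeFloor 𝓘 (1/80) ⟸ CellsGood N P ∧ ExactCert N P bends0 (1/80) ∧ ExactCovers N P bends0 𝓘`, and `ExactCovers ⟸ ParamWindow 𝒲 bends0 𝓘 ∧ BoxesCover N P 𝒲`
with only the QUARTER-BOX window (`‖G − 1‖ ≤ 1/4 ∧ ‖ξ‖ ≤ 1/4`, 9 + 3 dimensions, no rotation quotient) proved for `𝓘 = FamP`.

## THE NODE (three layers, every junction PROVED, 0 sorry; imports ONLY the tree)

**§1 ROTATION GAUGE (critic row 1092 task #0 «ROT», discharged).**  `FamG 𝒲 ⊆ FamP` = the instances of record that are PRESENTED with parameters in the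
window `𝒲`; `ParamWindow 𝒲 bends0 (FamG 𝒲)` holds BY DEFINITION (`paramWindow_famG`), so 62B's box covers may be run over ANY census window `𝒲` once
`Rotatable 𝒲 := every FamP-instance has a rotated copy in FamG 𝒲` is known; and ★ `CoverP → Rotatable 𝒲 → FamilyCover (FamG 𝒲) (24/5) (1/100) (1/8) (1/80)`
(`familyCover_famG_of_coverP_of_rotatable`: compose the cover's isometry with the gauge rotation — `ChartBy` is relative-position based, `chartBy_comp`), hence
★★ `TubeFloor (FamG 𝒲) (1/80) → CoverP → Rotatable 𝒲 → [CORE-FAR]` (`coreOff_record_of_tubeG_of_coverP_of_rotatable`).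

**§2 THE SYMMETRIC GAUGE IS ROTATABLE (PROVED).**  `WSym φ U ξ :⟺ U self-adjoint ∧ positive ∧ ‖U − 1‖ ≤ 1/4 ∧ ‖ξ‖ ≤ 1/4` (6 + 3 dimensions).
★★ `rotatable_WSym : Rotatable WSym` — from the tree's POLAR FACTOR `exists_polar_of_near_one` (`G = R ∘ U`, `‖U − 1‖ ≤ 1/4`) and the ROT KINEMATICS proved
here: `presentedBy_symm_comp` (an instance presented by `(φ, b, R·U, ξ)` has `R⁻¹ ∘ h` presented by `(φ, R⁻¹∘b∘R, U, ξ)`, via `latSet_mul`/`mem_homRange_mul_iff`),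
`conj_mem_polyBends` (`polyBends q₂ q₃` — in particular `bends0` — is closed under conjugation by linear isometries, norms of the forms preserved exactly),
`admissibleW_comp_iff`, `goodAtScale_comp_iff`.  Hence ★★★ `coreOff_record_of_tubeSym_of_coverP : TubeFloor (FamG WSym) (1/80) → CoverP → [CORE-FAR]` and the
thread to `StrainedPatchRec` (`strainedPatchRec_of_homFloor_625_of_tubeSym_of_coverP`); conversely `tubeSym_iff_tubeP` (nothing is lost).  For 62B this means: `BoxesCover N P WSym` (symmetric `U`-boxes × `ξ`-boxes,
branch by branch) replaces `BoxesCover N P quarter`; the reference-side form of ROT (references stored in any orientation) is `fatTubeFloor_comp_iff`.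

**§3 CELL STATUS: DEAD / SITEWISE / LIVE (the lens-5 bridge that makes 62B's finite range FINITE).**  `BoxesCover` over the (symmetric) quarter box forces
cells at references far outside the admissible strain shell, where (FT) can only hold VACUOUSLY.  Typed here, generic over the reference `(z₁, c₁, τ, κ, lam)` so
that it composes with 61H `NetCert` and 62B `ExactCert` (`= ∀ k G ξ b, … → FatTubeFloor (bendAt b (N.ref k G ξ) (N.c k)) (N.c k) (1/80) 0 0`) alike:
`Charted` (the four hypotheses of one instance of (FT)), `DeadRef` (no cluster is charted ⟹ (FT), `fatTubeFloor_of_deadRef`), `SitewiseRef` (all member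
surpluses `≥ 0` ⟹ (FT), `fatTubeFloor_of_sitewiseRef`), the three-way status junction `fatTubeFloor_of_status` / `netCert_of_status`; the WINDOW TRANSFER
through the bond chart, PROVED: (T1) `charted_ref_site_good` — every reference site within `6` of `c₁` is the label of a `1/8`-GOOD cluster site within `63/10`;
(T2) `admissible_window_lo` — admissibility forbids, within `9/2` of the cluster centre, every `1/20`-good site and every non-equilibrium-core witness
(`¬ExemptNear (9/5) ExRec` read at the member `j = c`); (T3) `charted_dist_centre_le` — the cluster preimage of `a₁` lies within `d₁ + 2τ + κ d₁ + lam d₁²` of `c`.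
The census's INFEASIBILITY CERTIFICATES are the three typed witnesses `LooseWitness` / `TightWitness` / `CoreWitness` at ONE reference site `a₁`
(every cluster site charted onto `a₁` is not `1/8`-good / is `1/20`-good / carries a core witness), each ⟹ `DeadRef` (`deadRef_of_looseWitness`,
`deadRef_of_tightWitness`, `deadRef_of_coreWitness`).  LEAVES: the distance-level sufficient conditions for the witnesses (shell rigidity for `TightWitness`,
radial necessary conditions of `1/8`-goodness for `LooseWitness`) — ATTACKABLE (memo §3); the live-cell count — INSTRUMENTABLE (BT-62 (α)).

PIECES AND TAGS.  `[CORE-FAR] ⟸ TubeFloor (FamG WSym) (1/80)` [CERTIFICATE over the GAUGE-FIXED family · EQUIVALENT to TubeP (`tubeSym_iff_tubeP`: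
rotate cluster and instance together) — an O(3) QUOTIENT of the certificate's domain, not a weakening · UNDECIDED · INSTRUMENTABLE ← 62B cells over
`WSym`-boxes, BT-62] `∧ CoverP` [GEOMETRIC · unchanged · UNDECIDED · INSTRUMENTABLE ← COVER-60/63].
Nothing here is COSTUME: §1–§2 remove three of the twelve window dimensions from every downstream box count at zero cost in hypotheses; §3 turns
«cells outside THE BOX» into typed one-site certificates.  Tree-only imports; no `sorry`; no new axioms.
-/

noncomputable section

namespace Summit.AtomisticToContinuum.Crystallization.Theorems.FrustratedLawDichotomyStrainedPatchGaugeCells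

open scoped BigOperators Classical RealInnerProductSpace
open Summit.AtomisticToContinuum.Crystallization.Theorems.FrustratedLawDichotomyPeriodicBlockFlags (goodAtScale_mono)
open Summit.AtomisticToContinuum.Crystallization.Theorems.FrustratedLawDichotomyRangeCut (Sep)
open Summit.AtomisticToContinuum.Crystallization.Theorems.FrustratedLawDichotomyMotifLemmas
open Summit.AtomisticToContinuum.Crystallization.Theorems.FrustratedLawDichotomyAveragingCut
open Summit.AtomisticToContinuum.Crystallization.Theorems.FrustratedLawDichotomyAveragingRuleCap
open Summit.AtomisticToContinuum.Crystallization.Theorems.FrustratedLawDichotomyAveragingRuleTightFree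
open Summit.AtomisticToContinuum.Crystallization.Theorems.FrustratedLawDichotomyExemptDoor (SitePred)
open Summit.AtomisticToContinuum.Crystallization.Theorems.FrustratedLawDichotomyExemptAbsorption
open Summit.AtomisticToContinuum.Crystallization.Theorems.FrustratedLawDichotomyExemptAbsorptionRecord
open Summit.AtomisticToContinuum.Crystallization.Theorems.FrustratedLawDichotomyCollarCensus
open Summit.AtomisticToContinuum.Crystallization.Theorems.FrustratedLawDichotomyCollarCensusKappa
open Summit.AtomisticToContinuum.Crystallization.Theorems.FrustratedLawDichotomyStrainedPatchHomSplit
open Summit.AtomisticToContinuum.Crystallization.Theorems.FrustratedLawDichotomyStrainedPatchCleanCollar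
open Summit.AtomisticToContinuum.Crystallization.Theorems.FrustratedLawDichotomyStrainedPatchHomTube
open Summit.AtomisticToContinuum.Crystallization.Theorems.FrustratedLawDichotomyStrainedPatchHomPolar
open Summit.AtomisticToContinuum.Crystallization.Theorems.FrustratedLawDichotomyStrainedPatchHomIsometry
open Summit.AtomisticToContinuum.Crystallization.Theorems.FrustratedLawDichotomyStrainedPatchHomTubeIso
open Summit.AtomisticToContinuum.Crystallization.Theorems.FrustratedLawDichotomyStrainedPatchPhaseCut
open Summit.AtomisticToContinuum.Crystallization.Theorems.FrustratedLawDichotomyStrainedPatchCoreTube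
open Summit.AtomisticToContinuum.Crystallization.Theorems.FrustratedLawDichotomyStrainedPatchCoreTubeRecord
open Summit.AtomisticToContinuum.Crystallization.Theorems.FrustratedLawDichotomyStrainedPatchCoreTubeMilli
open Summit.AtomisticToContinuum.Crystallization.Theorems.FrustratedLawDichotomyStrainedPatchStrainBands
open Summit.AtomisticToContinuum.Crystallization.Theorems.FrustratedLawDichotomyStrainedPatchChartFamilies
open Summit.AtomisticToContinuum.Crystallization.Theorems.FrustratedLawDichotomyStrainedPatchChartFamiliesBent
open Summit.AtomisticToContinuum.Crystallization.Theorems.FrustratedLawDichotomyStrainedPatchChartFamiliesPinned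
open Summit.AtomisticToContinuum.Crystallization.Theorems.FrustratedLawDichotomyStrainedPatchRecutPairs
open Summit.AtomisticToContinuum.Crystallization.Theorems.FrustratedLawDichotomyStrainedPatchRecutKinematics
open Summit.AtomisticToContinuum.Crystallization.Theorems.FrustratedLawDichotomyStrainedPatchWindowFamilies
open Summit.AtomisticToContinuum.Crystallization.Theorems.FrustratedLawDichotomyStrainedPatchHostCells

/-! ## §1. The rotation gauge: presented sub-families, their window, and the record node over a gauge-fixed family -/

/-- **`ParamWindow 𝒲 𝓑₀ 𝓘`** (62B §9, verbatim) — every instance of `𝓘` has a presentation `(φ, b₀, G, ξ)`, `b₀ ∈ 𝓑₀`, with parameters in the window `𝒲`. -/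
def ParamWindow (𝒲 : Bool → (E3 →L[ℝ] E3) → E3 → Prop) (𝓑₀ : Set (E3 → E3)) (𝓘 : (M₀ : ℕ) → (Fin M₀ → E3) → Fin M₀ → Prop) : Prop :=
  ∀ (M₀ : ℕ) (h : Fin M₀ → E3) (c₀ : Fin M₀), 𝓘 M₀ h c₀ →
    ∃ (φ : Bool) (b₀ : E3 → E3) (G : E3 →L[ℝ] E3) (ξ : E3), b₀ ∈ 𝓑₀ ∧ 𝒲 φ G ξ ∧ PresentedBy φ b₀ G ξ (133 / 10) h c₀

/-- ★ **`FamG 𝒲` — the GAUGE-FIXED family of record**: instances of `FamP` PRESENTED by some `(φ, b₀, G, ξ)`, `b₀ ∈ bends0`, with `𝒲 φ G ξ`. -/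
def FamG (𝒲 : Bool → (E3 →L[ℝ] E3) → E3 → Prop) : (M₀ : ℕ) → (Fin M₀ → E3) → Fin M₀ → Prop :=
  fun M₀ h c₀ => FamP M₀ h c₀ ∧ ∃ (φ : Bool) (b₀ : E3 → E3) (G : E3 →L[ℝ] E3) (ξ : E3), b₀ ∈ bends0 ∧ 𝒲 φ G ξ ∧ PresentedBy φ b₀ G ξ (133 / 10) h c₀

/-- `FamG 𝒲 ⊆ FamP`. [formal bookkeeping] -/
theorem famG_le_famP (𝒲 : Bool → (E3 →L[ℝ] E3) → E3 → Prop) : FamilyLE (FamG 𝒲) FamP := fun _ _ _ h => h.1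

/-- ★ The window of the gauge-fixed family holds BY DEFINITION (62B's `ParamWindow` hypothesis for `𝓘 = FamG 𝒲`, any `𝒲`). [formal bookkeeping] -/
theorem paramWindow_famG (𝒲 : Bool → (E3 →L[ℝ] E3) → E3 → Prop) : ParamWindow 𝒲 bends0 (FamG 𝒲) := fun _ _ _ h => h.2

/-- Instances of the gauge-fixed family are `7/10`-separated (62B's `hsepI` hypothesis). [formal bookkeeping] -/
theorem famG_sep (𝒲 : Bool → (E3 →L[ℝ] E3) → E3 → Prop) (M₀ : ℕ) (h : Fin M₀ → E3) (c₀ : Fin M₀) (hI : FamG 𝒲 M₀ h c₀) : Sep h := hI.1.1.2.1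

/-- The gauge-fixed tube floor is WEAKER than (TF)ᴾ. [formal bookkeeping] -/
theorem tubeFloor_famG_of_tubeP (𝒲 : Bool → (E3 →L[ℝ] E3) → E3 → Prop) (h : TubeP) : TubeFloor (FamG 𝒲) (1 / 80) :=
  h.anti_family (famG_le_famP 𝒲)

/-- **`Rotatable 𝒲` [the ROTATION QUOTIENT for the window `𝒲`]** — every instance of record has a ROTATED copy in the gauge-fixed family. -/
def Rotatable (𝒲 : Bool → (E3 →L[ℝ] E3) → E3 → Prop) : Prop :=
  ∀ (M₀ : ℕ) (h : Fin M₀ → E3) (c₀ : Fin M₀), FamP M₀ h c₀ → ∃ R : E3 ≃ₗᵢ[ℝ] E3, FamG 𝒲 M₀ (⇑R ∘ h) c₀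

/-- Relative positions are rotated together: `dist (R u − R w) (R u₀ − R w₀) = dist (u − w) (u₀ − w₀)`. [formal bookkeeping] -/
theorem dist_sub_map (R : E3 ≃ₗᵢ[ℝ] E3) (u w u₀ w₀ : E3) : dist (R u - R w) (R u₀ - R w₀) = dist (u - w) (u₀ - w₀) := by
  rw [← map_sub, ← map_sub, LinearIsometryEquiv.dist_map]

/-- ★ `ChartBy` is covariant under a SIMULTANEOUS linear isometry of cluster and instance (it only reads relative positions and cluster distances). [folklore] -/
theorem chartBy_comp {𝓘 𝓘' : (M₀ : ℕ) → (Fin M₀ → E3) → Fin M₀ → Prop} {τ t : ℝ} {M : ℕ} {z : Fin M → E3} {c : Fin M} {M₀ : ℕ} {z₀ : Fin M₀ → E3}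
    {c₀ : Fin M₀} {e : Fin M → Fin M₀} (R : E3 ≃ₗᵢ[ℝ] E3) (h : ChartBy 𝓘 τ t z c z₀ c₀ e) (h' : 𝓘' M₀ (⇑R ∘ z₀) c₀) :
    ChartBy 𝓘' τ t (⇑R ∘ z) c (⇑R ∘ z₀) c₀ e := by
  obtain ⟨-, hec, hco, hfi, hinj, hcov⟩ := h
  have hd : ∀ a b : Fin M, dist ((⇑R ∘ z) a) ((⇑R ∘ z) b) = dist (z a) (z b) := fun a b => dist_comp R z a b
  have hrel : ∀ a, dist ((⇑R ∘ z) a - (⇑R ∘ z) c) ((⇑R ∘ z₀) (e a) - (⇑R ∘ z₀) c₀) = dist (z a - z c) (z₀ (e a) - z₀ c₀) := fun a =>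
    dist_sub_map R (z a) (z c) (z₀ (e a)) (z₀ c₀)
  refine ⟨h', hec, fun a ha => ?_, fun a ha hun => ?_, fun a b ha hb hab => ?_, fun b₀ hb₀ => ?_⟩
  · rw [hrel]; rw [hd] at ha; exact hco a ha
  · rw [hrel]; rw [hd] at ha
    exact hfi a ha fun j hj => by have h₁ := hun j (by rw [hd]; exact hj); rwa [hd] at h₁
  · rw [hd] at ha hb; exact hinj a b ha hb hab
  · rw [dist_comp] at hb₀
    obtain ⟨a, ha, hea⟩ := hcov b₀ hb₀
    exact ⟨a, by rw [hd]; exact ha, hea⟩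

/-- ★★ **THE GAUGE COVER**: (BC)ᴾ ∧ `Rotatable 𝒲` ⟹ the cover by the GAUGE-FIXED family (compose the two isometries). [folklore] -/
theorem familyCover_famG_of_coverP_of_rotatable {𝒲 : Bool → (E3 →L[ℝ] E3) → E3 → Prop} (hC : CoverP) (hR : Rotatable 𝒲) :
    FamilyCover (FamG 𝒲) (24 / 5) (1 / 100) (1 / 8) (1 / 80) := by
  intro M z c hz hcl hm hn hg
  obtain ⟨R₀, M₀, h, c₀, e, hch⟩ := hC M z c hz hcl hm hn hg
  obtain ⟨R₁, hG⟩ := hR M₀ h c₀ hch.1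
  refine ⟨R₀.trans R₁, M₀, ⇑R₁ ∘ h, c₀, e, ?_⟩
  have hcomp : ⇑(R₀.trans R₁) ∘ z = ⇑R₁ ∘ (⇑R₀ ∘ z) := by rw [LinearIsometryEquiv.coe_trans]; rfl
  rw [hcomp]
  exact chartBy_comp R₁ hch hG

/-- ★★ **THE RECORD NODE OVER A GAUGE-FIXED FAMILY**: `TubeFloor (FamG 𝒲) (1/80) → CoverP → Rotatable 𝒲 → [CORE-FAR]`. [folklore] -/
theorem coreOff_record_of_tubeG_of_coverP_of_rotatable {𝒲 : Bool → (E3 →L[ℝ] E3) → E3 → Prop} (hT : TubeFloor (FamG 𝒲) (1 / 80)) (hC : CoverP)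
    (hR : Rotatable 𝒲) : CoreOffTubeFloor (63 / 10) (63 / 10) (24 / 5) (1 / 100) 0 :=
  coreOff_of_tubeFloor_of_cover_eighth hT (familyCover_famG_of_coverP_of_rotatable hC hR)

/-- ★ Conversely, a gauge-fixed tube floor gives (TF)ᴾ back when the window is rotatable: rotate cluster AND instance together (`chartBy_comp`), the score is
isometry-invariant (`ballAvg_xRec_comp`).  So the gauge fixing is an O(3) QUOTIENT of the certificate's domain, not a weakening. [folklore] -/
theorem tubeP_of_tubeG_of_rotatable {𝒲 : Bool → (E3 →L[ℝ] E3) → E3 → Prop} (hT : TubeFloor (FamG 𝒲) (1 / 80)) (hR : Rotatable 𝒲) : TubeP := by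
  intro M z c M₀ h c₀ e hz hcl hm hch
  obtain ⟨R, hG⟩ := hR M₀ h c₀ hch.1
  have h₁ := hT M (⇑R ∘ z) c M₀ (⇑R ∘ h) c₀ e ((admissible_comp_iff R z c).2 hz) ((cleanBall_comp_iff R z c).2 hcl)
    ((monoPhaseBall_comp_iff R z c).2 hm) (chartBy_comp R hch hG)
  rwa [ballAvg_xRec_comp] at h₁

/-- ★ `TubeFloor (FamG 𝒲) (1/80) ↔ TubeP` for every rotatable window. [folklore] -/
theorem tubeG_iff_tubeP {𝒲 : Bool → (E3 →L[ℝ] E3) → E3 → Prop} (hR : Rotatable 𝒲) : TubeFloor (FamG 𝒲) (1 / 80) ↔ TubeP :=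
  ⟨fun h => tubeP_of_tubeG_of_rotatable h hR, tubeFloor_famG_of_tubeP 𝒲⟩

/-- Rotatability is MONOTONE in the window. [formal bookkeeping] -/
theorem Rotatable.mono {𝒲 𝒲' : Bool → (E3 →L[ℝ] E3) → E3 → Prop} (h : Rotatable 𝒲) (hle : ∀ φ G ξ, 𝒲 φ G ξ → 𝒲' φ G ξ) : Rotatable 𝒲' := by
  intro M₀ h₀ c₀ hF
  obtain ⟨R, hP, φ, b₀, G, ξ, hb, hW, hPr⟩ := h M₀ h₀ c₀ hF
  exact ⟨R, hP, φ, b₀, G, ξ, hb, hle φ G ξ hW, hPr⟩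

/-! ## §2. The symmetric gauge is rotatable: polar factor + ROT kinematics -/

/-- `U` is self-adjoint. -/
def SymOp (U : E3 →L[ℝ] E3) : Prop := ∀ v w : E3, ⟪U v, w⟫ = ⟪v, U w⟫

/-- `U` is positive. -/
def PosOp (U : E3 →L[ℝ] E3) : Prop := ∀ w : E3, 0 ≤ ⟪w, U w⟫

/-- ★ **`WSym` — THE SYMMETRIC QUARTER WINDOW** (6 strain + 3 offset dimensions): `U` self-adjoint positive, `‖U − 1‖ ≤ 1/4`, `‖ξ‖ ≤ 1/4` (both branches). -/
def WSym : Bool → (E3 →L[ℝ] E3) → E3 → Prop := fun _ U ξ => SymOp U ∧ PosOp U ∧ ‖U - 1‖ ≤ 1 / 4 ∧ ‖ξ‖ ≤ 1 / 4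

/-- The linear isometry as an endomorphism applies as the isometry. [formal bookkeeping] -/
theorem coeCLM_apply (R : E3 ≃ₗᵢ[ℝ] E3) (v : E3) : (R : E3 →L[ℝ] E3) v = R v := rfl

/-- ★ **`polyBends q₂ q₃` is closed under conjugation by linear isometries** (`b ↦ R⁻¹ ∘ b ∘ R`; the norms of the forms are preserved exactly). [folklore] -/
theorem conj_mem_polyBends {q₂ q₃ : ℝ} {b : E3 → E3} (hb : b ∈ polyBends q₂ q₃) (R : E3 ≃ₗᵢ[ℝ] E3) : (⇑R.symm ∘ b ∘ ⇑R) ∈ polyBends q₂ q₃ := by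
  obtain ⟨Q, C, hQ, hC, hbv⟩ := hb
  let Rl : E3 →ₗ[ℝ] E3 := (R.toLinearEquiv : E3 →ₗ[ℝ] E3)
  let Sl : E3 →ₗ[ℝ] E3 := (R.symm.toLinearEquiv : E3 →ₗ[ℝ] E3)
  let Q₁ : E3 →ₗ[ℝ] E3 →ₗ[ℝ] E3 := (Q.compl₁₂ Rl Rl).compr₂ Sl
  let L : (E3 →ₗ[ℝ] E3) →ₗ[ℝ] (E3 →ₗ[ℝ] E3) := (LinearMap.llcomp ℝ E3 E3 E3 Sl).comp (LinearMap.lcomp ℝ E3 Rl)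
  let C₁ : E3 →ₗ[ℝ] E3 →ₗ[ℝ] E3 →ₗ[ℝ] E3 := (C.compl₁₂ Rl Rl).compr₂ L
  have hRl : ∀ u, Rl u = R u := fun u => rfl
  have hSl : ∀ u, Sl u = R.symm u := fun u => rfl
  have hQ₁ : ∀ u v, Q₁ u v = R.symm (Q (R u) (R v)) := fun u v => by
    simp only [Q₁, LinearMap.compr₂_apply, LinearMap.compl₁₂_apply, hRl, hSl]
  have hC₁ : ∀ u v w, C₁ u v w = R.symm (C (R u) (R v) (R w)) := fun u v w => by
    simp only [C₁, L, LinearMap.compr₂_apply, LinearMap.compl₁₂_apply, LinearMap.comp_apply, LinearMap.llcomp_apply, LinearMap.lcomp_apply, hRl, hSl]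
  refine ⟨Q₁, C₁, fun u v => ?_, fun u v w => ?_, fun v => ?_⟩
  · rw [hQ₁, LinearIsometryEquiv.norm_map]
    simpa only [LinearIsometryEquiv.norm_map] using hQ (R u) (R v)
  · rw [hC₁, LinearIsometryEquiv.norm_map]
    simpa only [LinearIsometryEquiv.norm_map] using hC (R u) (R v) (R w)
  · show R.symm (b (R v)) = v + Q₁ v v + C₁ v v v
    rw [hQ₁, hC₁, hbv, map_add, map_add, LinearIsometryEquiv.symm_apply_apply]

/-- `bends0` is closed under conjugation by linear isometries. [formal bookkeeping] -/
theorem conj_mem_bends0 {b : E3 → E3} (hb : b ∈ bends0) (R : E3 ≃ₗᵢ[ℝ] E3) : (⇑R.symm ∘ b ∘ ⇑R) ∈ bends0 := conj_mem_polyBends hb R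

/-- ★ **ROT KINEMATICS**: an instance presented by `(φ, b, R·U, ξ)` has its rotated copy `R⁻¹ ∘ h` presented by `(φ, R⁻¹∘b∘R, U, ξ)` — same branch, same offset,
skeleton `a ↦ R⁻¹ (z₀ a − z₀ c₀)` (the `U`-lattice window through the origin). [folklore] -/
theorem presentedBy_symm_comp {φ : Bool} {b : E3 → E3} {U : E3 →L[ℝ] E3} {ξ : E3} {ρ : ℝ} {M : ℕ} {h : Fin M → E3} {c₀ : Fin M} (R : E3 ≃ₗᵢ[ℝ] E3)
    (hU : ‖U - 1‖ ≤ 1 / 4) (hP : PresentedBy φ b ((R : E3 →L[ℝ] E3) * U) ξ ρ h c₀) : PresentedBy φ (⇑R.symm ∘ b ∘ ⇑R) U ξ ρ (⇑R.symm ∘ h) c₀ := by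
  obtain ⟨-, hξ, z₀, hr, hab⟩ := hP
  have hc : (fun a => R.symm (z₀ a - z₀ c₀)) c₀ = 0 := by simp
  refine ⟨hU, hξ, fun a => R.symm (z₀ a - z₀ c₀), ?_, fun a => ?_⟩
  · rw [hc]
    ext x
    rw [mem_homRange_iff, Set.mem_range, dist_zero_right, sub_zero]
    constructor
    · rintro ⟨a, rfl⟩
      have ha : z₀ a ∈ homRange φ ((R : E3 →L[ℝ] E3) * U) ξ ρ (z₀ c₀) := hr ▸ Set.mem_range_self a
      obtain ⟨hd, v, hv, hva⟩ := mem_homRange_mul_iff.1 ha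
      rw [hva, coeCLM_apply, LinearIsometryEquiv.symm_apply_apply]
      refine ⟨?_, hv⟩
      rw [← (R : E3 ≃ₗᵢ[ℝ] E3).norm_map v, ← coeCLM_apply, ← hva, ← dist_eq_norm]; exact hd
    · rintro ⟨hx, hv⟩
      have hmem : z₀ c₀ + R x ∈ homRange φ ((R : E3 →L[ℝ] E3) * U) ξ ρ (z₀ c₀) := by
        rw [mem_homRange_mul_iff]
        refine ⟨by rw [dist_eq_norm, add_sub_cancel_left, LinearIsometryEquiv.norm_map]; exact hx, x, hv, ?_⟩
        rw [add_sub_cancel_left, coeCLM_apply]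
      rw [← hr] at hmem
      obtain ⟨a, ha⟩ := hmem
      exact ⟨a, by rw [ha, add_sub_cancel_left, LinearIsometryEquiv.symm_apply_apply]⟩
  · simp only [Function.comp_apply, sub_self, map_zero, sub_zero, LinearIsometryEquiv.apply_symm_apply]
    rw [← map_sub, hab]

/-- `AdmissibleW (R ∘ z) c ↔ AdmissibleW z c` (every conjunct is isometry-invariant). [folklore] -/
theorem admissibleW_comp_iff (R : E3 ≃ₗᵢ[ℝ] E3) {M : ℕ} (z : Fin M → E3) (c : Fin M) : AdmissibleW M (⇑R ∘ z) c ↔ AdmissibleW M z c := by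
  unfold AdmissibleW
  rw [injective_comp_iff, sep_comp_iff, tightNearCap_comp_iff, exemptNear_exRec_comp_iff, badNearCap_comp_iff]
  simp only [dist_comp]

/-- A deformation given pointwise as `R ∘ U` is the endomorphism product `R · U`. [formal bookkeeping] -/
theorem eq_coe_mul_of_apply {G U : E3 →L[ℝ] E3} {R : E3 ≃ₗᵢ[ℝ] E3} (h : ∀ w, G w = R (U w)) : G = (R : E3 →L[ℝ] E3) * U := by
  ext w : 1
  rw [h w, mul_apply_vec, coeCLM_apply]

/-- ★★ **THE SYMMETRIC GAUGE IS ROTATABLE** (ROT, critic row 1092 task #0): every instance of record, rotated by the inverse of the orthogonal polar factor of its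
presentation matrix, is an instance of record presented with a SELF-ADJOINT POSITIVE matrix `U`, `‖U − 1‖ ≤ 1/4`, the same branch, the same offset and a
conjugate `bends0`-bend. [folklore: polar decomposition] -/
theorem rotatable_WSym : Rotatable WSym := by
  intro M₀ h c₀ hF
  obtain ⟨hA, hB, hg⟩ := hF
  obtain ⟨φ, b, G, ξ, hb, hP⟩ := exists_presentedBy_of_isBentBall hB
  obtain ⟨R, U, hsa, hpos, hU1, -, hGRU⟩ := exists_polar_of_near_one hP.1 (by norm_num : (1 / 4 : ℝ) < 1)
  rw [eq_coe_mul_of_apply hGRU] at hP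
  have hP' := presentedBy_symm_comp R hU1 hP
  have hb' : (⇑R.symm ∘ b ∘ ⇑R) ∈ bends0 := conj_mem_bends0 hb R
  exact ⟨R.symm, ⟨(admissibleW_comp_iff R.symm h c₀).2 hA, isBentBall_of_presentedBy hb' hP', (goodAtScale_comp_iff R.symm h c₀).2 hg⟩,
    φ, _, U, ξ, hb', ⟨hsa, hpos, hU1, hP'.2.1⟩, hP'⟩

/-- ★★ **(TF) OVER THE SYMMETRIC GAUGE ⟺ (TF)ᴾ**: `TubeFloor (FamG WSym) (1/80) ↔ TubeP`. [folklore] -/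
theorem tubeSym_iff_tubeP : TubeFloor (FamG WSym) (1 / 80) ↔ TubeP := tubeG_iff_tubeP rotatable_WSym

/-- ★★ The gauge cover of record: (BC)ᴾ ⟹ the cover by the SYMMETRIC-GAUGE family. [folklore] -/
theorem familyCover_famSym_of_coverP (hC : CoverP) : FamilyCover (FamG WSym) (24 / 5) (1 / 100) (1 / 8) (1 / 80) :=
  familyCover_famG_of_coverP_of_rotatable hC rotatable_WSym

/-- ★★★ **THE RECORD NODE OF g63**: `TubeFloor (FamG WSym) (1/80) → CoverP → CoreOffTubeFloor (63/10) (63/10) (24/5) (1/100) 0` — the certificate side need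
only treat instances presented with a self-adjoint positive `U` (62B: `BoxesCover N P WSym` in place of the quarter box). [folklore] -/
theorem coreOff_record_of_tubeSym_of_coverP (hT : TubeFloor (FamG WSym) (1 / 80)) (hC : CoverP) :
    CoreOffTubeFloor (63 / 10) (63 / 10) (24 / 5) (1 / 100) 0 :=
  coreOff_record_of_tubeG_of_coverP_of_rotatable hT hC rotatable_WSym

/-- ★ Threaded to the 27623 piece through the tree's record assembly (pieces of record as hypotheses, residual floor `φ₁ = 0`), `TubeP` replaced by the
gauge-fixed tube floor. [formal bookkeeping] -/
theorem strainedPatchRec_of_homFloor_625_of_tubeSym_of_coverP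
    (hHF : HomFloor (1 / 625)) (hT : TailPenalty (24 / 5) (1 / 1000)) (hRl : CoreCoreRelief (63 / 10) (63 / 10) (24 / 5) (1 / 100) (3 / 5000))
    (hTS : TubeFloor (FamG WSym) (1 / 80)) (hC : CoverP) (hF : AnnularPhaseFloor (63 / 10) (24 / 5) (63 / 10) (1 / 1000))
    (hP : PolyTextureFloor (63 / 10) (24 / 5) (1 / 1000)) (hA : AnnularDefectFloor (24 / 5) (63 / 10)) (hD : DefectiveCollarFloor (24 / 5)) : StrainedPatchRec :=
  strainedPatchRec_of_homFloor_of_tailPenalty_of_coreRelief_of_coreOff_of_annularPhase_of_poly_of_annular_of_near (by norm_num) hHF hT hRl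
    seam_arith_core (coreOff_record_of_tubeSym_of_coverP hTS hC) hF hP le_rfl (by norm_num) (by norm_num) hA hD

/-- The reference-side form of ROT: a bond chart reads the REFERENCE only through its pair distances, so (FT) at `R ∘ z₁` is (FT) at `z₁` (references may be
stored in any orientation; 62B's `bendAt b (R·ref)` vs `R·bendAt (R⁻¹bR) ref`). [folklore] -/
theorem bondChart_comp_ref_iff (R : E3 ≃ₗᵢ[ℝ] E3) {τ κ lam : ℝ} {M : ℕ} (z : Fin M → E3) (c : Fin M) {M₁ : ℕ} (z₁ : Fin M₁ → E3) (c₁ : Fin M₁)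
    (e' : Fin M → Fin M₁) : BondChart τ κ lam z c (⇑R ∘ z₁) c₁ e' ↔ BondChart τ κ lam z c z₁ c₁ e' := by
  unfold BondChart; simp only [dist_comp]

/-- `FatTubeFloor (R ∘ z₁) c₁ τ κ lam ↔ FatTubeFloor z₁ c₁ τ κ lam`. [folklore] -/
theorem fatTubeFloor_comp_iff (R : E3 ≃ₗᵢ[ℝ] E3) {M₁ : ℕ} (z₁ : Fin M₁ → E3) (c₁ : Fin M₁) (τ κ lam : ℝ) :
    FatTubeFloor (⇑R ∘ z₁) c₁ τ κ lam ↔ FatTubeFloor z₁ c₁ τ κ lam := by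
  unfold FatTubeFloor; simp only [bondChart_comp_ref_iff]

end Summit.AtomisticToContinuum.Crystallization.Theorems.FrustratedLawDichotomyStrainedPatchGaugeCells
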